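import Literature.AlgebraicGeometry.Frobenioids.PadicFrobenioidSlim
import Literature.AlgebraicGeometry.Frobenioids.PadicFrobenioidIsFrobenioid
import Literature.AlgebraicGeometry.Frobenioids.PadicFrobenioidZeroMonoid
import HarnessLib

/-!
# Frobenioids II, Theorem 1.2 (iv) — capstone

Mochizuki, *The geometry of Frobenioids II*, Kyushu J. Math. **62** (2008), §1, Theorem 1.2 (iv), kurims
p. 9 [cite: MochizukiFrdII2008, Thm 1.2 (iv) p.9]: "If `D` is slim, and `Λ ∈ {ℤ, ℝ}`, then `C` is also
slim." PROOF-ONLY capstone (node `FrdII:Thm1.2(iv)`, seat abc-iut-L1-d8): the assembly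
`thm12_iv_of_isFrobenioid'` (Prop. 1.13 (iii) route) composed with `isFrobenioid_of_isMonoidData`
([FrdI] Thm. 5.2 (ii) for the datum) gives Theorem 1.2 (iv) for `Λ = ℤ` under the single standing
hypothesis `d.IsMonoidData` of abc-iut-L1-t4's statement file ("`Φ`, `B` are monoids on `D`", the
requirement under which Ex. 1.1 (ii) invokes Thm. 5.2); and UNCONDITIONALLY for the `p`-adic Frobenioid
`C₀|_D` of Ex. 1.1 (i) over any base `D → D₀` of FSM-type (`Datum.zero_isMonoidData`). No definitions.
-/

namespace Literature.AlgebraicGeometry.Frobenioids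

namespace PadicFrd

open CategoryTheory

universe v u

variable {D : Type u} [Category.{v} D] {p : ℕ} [Fact p.Prime]

/-- **Theorem 1.2 (iv)** (FrdII p. 9), `Λ = ℤ`: "If `D` is slim, then `C` is also slim", for the `p`-adic
Frobenioid of a datum `d` whose `Φ`, `B` are monoids on `D` (`d.IsMonoidData`, the standing requirement of
[FrdI] Thm. 5.2 behind Ex. 1.1 (ii)). [cite: MochizukiFrdII2008, Thm 1.2 (iv) p.9] -/
theorem Datum.thm12_iv_of_isMonoidData (d : Datum D p) (h : d.IsMonoidData) : Thm12_iv d :=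
  d.thm12_iv_of_isFrobenioid' (d.isFrobenioid_of_isMonoidData h)

/-- **Theorem 1.2 (iv)** for the `p`-adic Frobenioid `C₀|_D` of Example 1.1 (i) over a base `D → D₀` of
FSM-type (e.g. `D = D₀`): UNCONDITIONAL — "If `D` is slim, then `C` is also slim".
[cite: MochizukiFrdII2008, Thm 1.2 (iv) p.9] -/
theorem thm12_iv_zero (base : D ⥤ PadicFld.{u} p) (hloc : ∀ A : D, (base.obj A).IsPadicLocal)
    (hc : IsConnected D) (he : IsTotallyEpimorphic D)
    (hmono : ∀ A : D, IsMonoprime (OrdInt (base.obj A).K)) (hD : IsOfFSMType D) :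
    Thm12_iv (Datum.zero base hloc hc he hmono) :=
  (Datum.zero base hloc hc he hmono).thm12_iv_of_isMonoidData
    (Datum.zero_isMonoidData base hloc hc he hmono hD)

/-- The `p`-adic Frobenioid `C₀|_D` of Example 1.1 (i) over a base of FSM-type IS a Frobenioid
(FrdII Ex. 1.1 (i): "this data determines a [model] Frobenioid `C₀`"), unconditionally.
[cite: MochizukiFrdII2008, Ex 1.1 (i) p.7] -/
theorem isFrobenioid_zero (base : D ⥤ PadicFld.{u} p) (hloc : ∀ A : D, (base.obj A).IsPadicLocal)
    (hc : IsConnected D) (he : IsTotallyEpimorphic D)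
    (hmono : ∀ A : D, IsMonoprime (OrdInt (base.obj A).K)) (hD : IsOfFSMType D) :
    PreFrobenioid.IsFrobenioid (Datum.zero base hloc hc he hmono).structureFunctor :=
  (Datum.zero base hloc hc he hmono).isFrobenioid_of_isMonoidData
    (Datum.zero_isMonoidData base hloc hc he hmono hD)

end PadicFrd

end Literature.AlgebraicGeometry.Frobenioids
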